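import Literature.Geometry.Lorentzian.MaxAtlasChartKilling
import Literature.Geometry.Lorentzian.KillingOpensJetRigidity
import Literature.Geometry.Lorentzian.KillingAlgebraAsymptoticallyFlat
import Literature.Geometry.Lorentzian.LeviCivitaLocality
import HarnessLib

/-!
# Unique continuation of local Killing fields of a `C^∞` metric (O'Neill 1983, Ch. 9, Lemma 9.28)

Two Killing fields of a `C^∞` pseudo-Riemannian metric (any signature) ON an open preconnected set
`A` (`PseudoRiemannianMetric.IsKillingFieldOn`: `C^∞` on `A`, Killing equation at the points of `A`)
which agree near one point of `A` — in particular, which agree on a non-empty open subset of `A` —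
agree on all of `A`. O'Neill 1983, Ch. 9, Lemma 9.28 and the remark following it ("a Killing field
is determined by its values on any open set"; Kobayashi–Nomizu I, Ch. VI, Lemma 4 for Thm. 6.1),
for `C^∞` metrics on a manifold modelled on `𝓘(ℝ, E)`: the set of points near which the two fields
agree is open, and closed in `A` because around any point of `A` there is a chart of the maximal
atlas with ball-shaped target and source inside `A` (`exists_maximalAtlas_source_subset`); read in
it (`MaxAtlasChart.isKillingFieldOn_mpullback_inv`) the difference of the two fields is a GLOBAL
Killing field of the transported metric on the (preconnected) target vanishing near a point, hence
identically by one-jet rigidity (`OpensChart`-level `IsKillingField.eq_zero_of_oneJet_eq_zero'`,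
which needs no completeness and no analyticity), and we come back with
`MaxAtlasChart.apply_inv_eq_of_mpullback_eq`. The analytic-manifold version of the same statement
is `NomizuKillingExtension.killing_eqOn_of_eventuallyEq` (`NomizuKillingExtensionProofs.lean`); this
file is its `C^∞` counterpart ON THE LITERATURE SIDE — the same argument was run on the summit
side as `KillingRigidity.eqOn_of_eqOn_open` /
`stub_killingFieldOn_eqOn_of_isPreconnected` (hypothesis (G4) of the Killing-propagation stubs of the
crux `BondiBartnikRigidity`), which Literature files cannot import; it is needed here for the
coherence step of the Killing development
(`Literature.Geometry.Lorentzian.fischerMarsdenMoncrief_killing_development`).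

* (private) `exists_maximalAtlas_source_subset` — charts of the maximal atlas with preconnected
  (ball) target and source inside a given open set;
* `PseudoRiemannianMetric.IsKillingFieldOn.eqOn_of_isPreconnected_of_eventuallyEq` — the theorem
  (agreement near a point);
* `PseudoRiemannianMetric.IsKillingFieldOn.eqOn_of_isPreconnected_of_eqOn` — agreement on a
  non-empty open subset;
* `Spacetime.killingOn_eqOn_of_eqOn` — the specialisation to the spacetimes of the tree, in the
  exact form of hypothesis (G4) of `stub_killingPropagation'_of_facts`.

Everything is proved; no definitions, no named facts (D-0026).

## References

* B. O'Neill, *Semi-Riemannian geometry with applications to relativity*, Academic Press 1983,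
  Ch. 9, Prop. 9.25, Lemma 9.28 and the remark following it. [ONeill1983]
* S. Kobayashi, K. Nomizu, *Foundations of Differential Geometry* I, Wiley 1963, Ch. VI, Thm. 3.3,
  Lemma 4 for Thm. 6.1.
-/

noncomputable section

open Bundle Set Function Filter TopologicalSpace Manifold VectorField Metric
open scoped Manifold ContDiff Topology

namespace Literature.Geometry.Lorentzian

namespace PseudoRiemannianMetric

variable {E : Type*} [NormedAddCommGroup E] [NormedSpace ℝ E]
  {X : Type*} [TopologicalSpace X] [ChartedSpace E X]

/-- **Small charts of the maximal atlas inside an open set.** For `A` open and `y ∈ A` there is a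
chart `ψ` of the maximal `C^∞` atlas with `y ∈ ψ.source ⊆ A` and preconnected target (the
restriction of `chartAt y` to the preimage of a coordinate ball over `A`; Lee 2013, Prop. 1.16,
coordinate balls). (Private: the same statement is proved on the summit side as
`KillingRigidity.exists_chart_source_subset`, which Literature cannot import.) [folklore] -/
private theorem exists_maximalAtlas_source_subset [IsManifold 𝓘(ℝ, E) ∞ X] {A : Set X} (hA : IsOpen A)
    {y : X} (hy : y ∈ A) :
    ∃ ψ : OpenPartialHomeomorph X E, ψ ∈ IsManifold.maximalAtlas 𝓘(ℝ, E) ∞ X ∧ y ∈ ψ.source ∧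
      ψ.source ⊆ A ∧ IsPreconnected ψ.target := by
  set φ := chartAt E y with hφ
  have hys : y ∈ φ.source := mem_chart_source E y
  set O : Set E := φ.target ∩ φ.symm ⁻¹' A with hO
  have hOo : IsOpen O := φ.isOpen_inter_preimage_symm hA
  have hyO : φ y ∈ O := by
    refine ⟨φ.map_source hys, ?_⟩
    show φ.symm (φ y) ∈ A
    rw [φ.left_inv hys]
    exact hy
  obtain ⟨r, hr, hball⟩ := Metric.isOpen_iff.1 hOo _ hyO
  set S : Set X := φ.source ∩ φ ⁻¹' Metric.ball (φ y) r with hS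
  have hSo : IsOpen S := φ.isOpen_inter_preimage Metric.isOpen_ball
  refine ⟨φ.restr S, restr_mem_maximalAtlas _ (IsManifold.chart_mem_maximalAtlas y) hSo, ?_, ?_, ?_⟩
  · rw [φ.restr_source' S hSo]
    exact ⟨hys, hys, Metric.mem_ball_self hr⟩
  · rw [φ.restr_source' S hSo]
    rintro z ⟨hzs, -, hzb⟩
    have h : φ.symm (φ z) ∈ A := (hball hzb).2
    rwa [φ.left_inv hzs] at h
  · have htgt : (φ.restr S).target = Metric.ball (φ y) r := by
      rw [φ.restr_target, hSo.interior_eq]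
      ext e
      constructor
      · rintro ⟨he, hes⟩
        have h2 : φ (φ.symm e) ∈ Metric.ball (φ y) r := hes.2
        rwa [φ.right_inv he] at h2
      · intro he
        have het : e ∈ φ.target := (hball he).1
        refine ⟨het, φ.map_target het, ?_⟩
        show φ (φ.symm e) ∈ Metric.ball (φ y) r
        rw [φ.right_inv het]
        exact he
    rw [htgt]
    exact (convex_ball (φ y) r).isPreconnected

variable [FiniteDimensional ℝ E] [CompleteSpace E] [IsManifold 𝓘(ℝ, E) ∞ X]
  {g : PseudoRiemannianMetric 𝓘(ℝ, E) ∞ E (TangentSpace 𝓘(ℝ, E) : X → Type _)} [g.HasLeviCivita]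

/-- **Unique continuation of local Killing fields (`C^∞` metric).** Two Killing fields of `g` on an
open preconnected set `A` which agree near one point of `A` agree on `A`. O'Neill 1983, Ch. 9,
Lemma 9.28 and the remark following it; Kobayashi–Nomizu I, Ch. VI, Lemma 4 for Thm. 6.1. Proof in
the module docstring (clopen argument; closedness through a chart of the maximal atlas inside `A`,
the difference of the transported fields being a global Killing field of the transported metric with
vanishing one-jet at a point, `IsKillingField.eq_zero_of_oneJet_eq_zero'`).
[cite: ONeill1983, Ch. 9, Lemma 9.28] -/
theorem IsKillingFieldOn.eqOn_of_isPreconnected_of_eventuallyEq {A : Set X} (hA : IsOpen A)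
    (hAc : IsPreconnected A) {L₁ L₂ : Π x : X, TangentSpace 𝓘(ℝ, E) x}
    (h₁ : g.IsKillingFieldOn L₁ A) (h₂ : g.IsKillingFieldOn L₂ A) {x₀ : X} (hx₀ : x₀ ∈ A)
    (heq : L₁ =ᶠ[𝓝 x₀] L₂) : EqOn L₁ L₂ A := by
  let D : Set X := {y | L₁ =ᶠ[𝓝 y] L₂}
  have hDo : IsOpen D := isOpen_setOf_eventually_nhds
  have hsub : A ⊆ D := by
    refine hAc.subset_of_closure_inter_subset hDo ⟨x₀, hx₀, heq⟩ ?_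
    rintro y ⟨hyc, hyA⟩
    -- a chart of the maximal atlas around `y` with source inside `A` and preconnected target
    obtain ⟨ψ, hψ, hyψ, hψA, hpc⟩ := exists_maximalAtlas_source_subset (E := E) hA hyA
    haveI := (MaxAtlasChart.metric g hψ).hasLeviCivita
    -- the transported fields are global Killing fields of `Ψ^* g` on the target
    have hK : ∀ {L : Π x : X, TangentSpace 𝓘(ℝ, E) x}, g.IsKillingFieldOn L A →
        (MaxAtlasChart.metric g hψ).IsKillingField
          (mpullback 𝓘(ℝ, E) 𝓘(ℝ, E) (MaxAtlasChart.inv ψ) L) := by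
      intro L hL
      rw [← PseudoRiemannianMetric.isKillingFieldOn_univ]
      have h := MaxAtlasChart.isKillingFieldOn_mpullback_inv g hψ ψ.open_source (hL.mono hψA)
      have huniv : (MaxAtlasChart.inv ψ ⁻¹' ψ.source : Set (MaxAtlasChart.target ψ)) = univ :=
        eq_univ_of_forall fun p ↦ MaxAtlasChart.inv_mem_source p
      rwa [huniv] at h
    set Z : Π p : MaxAtlasChart.target ψ, TangentSpace 𝓘(ℝ, E) p :=
      mpullback 𝓘(ℝ, E) 𝓘(ℝ, E) (MaxAtlasChart.inv ψ) L₁ -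
        mpullback 𝓘(ℝ, E) 𝓘(ℝ, E) (MaxAtlasChart.inv ψ) L₂ with hZ
    have hZK : (MaxAtlasChart.metric g hψ).IsKillingField Z := (hK h₁).sub (hK h₂)
    -- a point of the chart source near which the two fields agree
    obtain ⟨y', hy's, hy'D⟩ : (ψ.source ∩ D).Nonempty := by
      rw [mem_closure_iff_nhds] at hyc
      simpa only [inter_comm] using hyc _ (ψ.open_source.mem_nhds hyψ)
    obtain ⟨p₀, hp₀⟩ := MaxAtlasChart.exists_inv_eq (ψ := ψ) hy's
    -- `Z` vanishes near `p₀`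
    have hcont : Continuous (MaxAtlasChart.inv ψ) :=
      ψ.continuousOn_symm.comp_continuous continuous_subtype_val fun p ↦ p.2
    have hev : Z =ᶠ[𝓝 p₀] (0 : Π p : MaxAtlasChart.target ψ, TangentSpace 𝓘(ℝ, E) p) := by
      have hy'D' : L₁ =ᶠ[𝓝 (MaxAtlasChart.inv ψ p₀)] L₂ := by rw [hp₀]; exact hy'D
      have h' : ∀ᶠ p in 𝓝 p₀, L₁ (MaxAtlasChart.inv ψ p) = L₂ (MaxAtlasChart.inv ψ p) :=
        hcont.continuousAt.eventually hy'D'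
      filter_upwards [h'] with p hp
      simp only [hZ, Pi.sub_apply, mpullback_apply, hp, sub_self, Pi.zero_apply]
    have h0 : Z p₀ = 0 := hev.self_of_nhds
    have h1 : ∀ v : E, (MaxAtlasChart.metric g hψ).leviCivita Z p₀ v = 0 := fun v ↦ by
      rw [PseudoRiemannianMetric.leviCivita_congr_nhds _ hev,
        (MaxAtlasChart.metric g hψ).leviCivita.zero]
      rfl
    have hall := PseudoRiemannianMetric.IsKillingField.eq_zero_of_oneJet_eq_zero'
      (U := MaxAtlasChart.target ψ) hpc hZK h0 h1
    -- back on `X`: the fields agree on the chart source, a neighbourhood of `y`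
    have hEq : ∀ x ∈ ψ.source, L₁ x = L₂ x := by
      intro x hx
      obtain ⟨p, rfl⟩ := MaxAtlasChart.exists_inv_eq (ψ := ψ) hx
      refine MaxAtlasChart.apply_inv_eq_of_mpullback_eq hψ (sub_eq_zero.1 ?_)
      exact hall p
    show L₁ =ᶠ[𝓝 y] L₂
    filter_upwards [ψ.open_source.mem_nhds hyψ] with x hx using hEq x hx
  intro y hy
  exact (show L₁ =ᶠ[𝓝 y] L₂ from hsub hy).self_of_nhds

/-- **A local Killing field is determined by its values on any non-empty open subset** of a
preconnected open domain. O'Neill 1983, Ch. 9, remark after Lemma 9.28.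
[cite: ONeill1983, Ch. 9, Lemma 9.28] -/
theorem IsKillingFieldOn.eqOn_of_isPreconnected_of_eqOn {A W : Set X} (hA : IsOpen A)
    (hAc : IsPreconnected A) (hW : IsOpen W) (hWA : W ⊆ A) (hWne : W.Nonempty)
    {L₁ L₂ : Π x : X, TangentSpace 𝓘(ℝ, E) x} (h₁ : g.IsKillingFieldOn L₁ A)
    (h₂ : g.IsKillingFieldOn L₂ A) (heq : ∀ y ∈ W, L₁ y = L₂ y) : EqOn L₁ L₂ A := by
  obtain ⟨x₀, hx₀⟩ := hWne
  exact h₁.eqOn_of_isPreconnected_of_eventuallyEq hA hAc h₂ (hWA hx₀)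
    (eventually_of_mem (hW.mem_nhds hx₀) heq)

end PseudoRiemannianMetric

/-- **Unique continuation of local Killing fields on a spacetime** — the statement in the exact form
of hypothesis (G4) of `stub_killingPropagation'_of_facts` (crux `BondiBartnikRigidity`): on a
`4`-dimensional spacetime, two Killing fields on an open preconnected `A` agreeing on a non-empty
open `W ⊆ A` agree on `A`. O'Neill 1983, Ch. 9, Lemma 9.28 and the remark following it.
[cite: ONeill1983, Ch. 9, Lemma 9.28] -/
theorem Spacetime.killingOn_eqOn_of_eqOn (𝒮 : Spacetime.{0} 4)
    [𝒮.metric.toPseudoRiemannianMetric.HasLeviCivita] (A W : Set 𝒮.carrier)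
    (ξ₁ ξ₂ : Π y : 𝒮.carrier, TangentSpace (𝓡 4) y) (hA : IsOpen A) (hAc : IsPreconnected A)
    (hW : IsOpen W) (hWA : W ⊆ A) (hWne : W.Nonempty) (h₁ : 𝒮.metric.IsKillingFieldOn ξ₁ A)
    (h₂ : 𝒮.metric.IsKillingFieldOn ξ₂ A) (heq : ∀ y ∈ W, ξ₁ y = ξ₂ y) :
    ∀ y ∈ A, ξ₁ y = ξ₂ y :=
  fun _ hy ↦ h₁.eqOn_of_isPreconnected_of_eqOn hA hAc hW hWA hWne h₂ heq hy

end Literature.Geometry.Lorentzian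

end
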